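import Summits.CriticalPhenomena.PercolationContinuityZ3.Theorems.PercNearOneGluingNoHeavyLowerTailFourCopyHubTriCertAlpha
import Summits.CriticalPhenomena.PercolationContinuityZ3.Theorems.PercNearOneGluingNoHeavyLowerTailTIncSwitching
import HarnessLib

/-!
# `NoHeavyLowerTail` (stmt-CriticalPhenomena-4575) — consequences of `alphaRow_holds`: rows `r7`, `r8`, class `α` for
# every `n`, and all nine E3GRP rows from the single remaining generator `γ`

Support file (prover prim-ineq-prove-3 gen 8; `--supports stmt-CriticalPhenomena-4575`; `--computational` because
`alphaRow_holds` rests on compiled evaluation).  No sorries.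

With `alphaRow_holds` (`…FourCopyHubTriCertAlpha`) and `TIncSwitching.tIncRow_holds`, the reductions of
`…E3GroupSepAlphaGlueRows` give `RowHolds 7`, `RowHolds 8` and `Row4Holds 4` unconditionally, and all nine rows /
all seven four-point classes from `GammaRow` alone.
-/

namespace Summit.CriticalPhenomena.PercolationContinuityZ3.Theorems

namespace CoSunflowerGlue

open FourCopyHub CovTransferCert E3GroupSepCert MeasureTheory Set Literature.Probability.LatticeModels Literature.Probability.Percolation

variable {n : ℕ}

/-- **Row `r7` on every finite weighted graph and every terminal tuple.** [this work] -/
theorem rowHolds_seven_all (w : Sym2 (Fin n) → unitInterval) (t : Tup n) : RowHolds 7 w t :=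
  rowHolds_seven_of_alphaRow alphaRow_holds w t

/-- **Row `r8` on every finite weighted graph and every terminal tuple.** [this work] -/
theorem rowHolds_eight_all (w : Sym2 (Fin n) → unitInterval) (t : Tup n) : RowHolds 8 w t :=
  rowHolds_eight_of_alphaRow alphaRow_holds w t

/-- **Class `α` (`Row4Holds 4`) for every `n`, weight and terminals.** [this work] -/
theorem row4Holds_four_all (w : Sym2 (Fin n) → unitInterval) (a b c y : Fin n) : Row4Holds 4 w (a, b, c, y) :=
  row4Holds_four_of_alphaRow alphaRow_holds w a b c y

/-- **All nine E3GRP rows from the single generator `γ`** (`T_inc` and `α` are theorems). [this work] -/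
theorem rowHolds_of_gammaRow (hG : GammaRow) (i : Fin 9) (w : Sym2 (Fin n) → unitInterval) (t : Tup n) :
    RowHolds i w t :=
  rowHolds_of_generators TIncSwitching.tIncRow_holds hG alphaRow_holds i w t

/-- **All seven four-point E3GRP classes from the single generator `γ`.** [this work] -/
theorem row4Holds_of_gammaRow (hG : GammaRow) (i : Fin 7) (w : Sym2 (Fin n) → unitInterval) (a b c y : Fin n) :
    Row4Holds i w (a, b, c, y) :=
  row4Holds_of_generators TIncSwitching.tIncRow_holds hG alphaRow_holds i w a b c y

end CoSunflowerGlue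

end Summit.CriticalPhenomena.PercolationContinuityZ3.Theorems
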